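import Summits.HodgeConjecture.CorCM.AbelianOddPartAtoms
import Summits.HodgeConjecture.CorCM.AbelianTwoGroupInvolutionLemmas
import Literature.NumberTheory.ComplexMultiplication.CMTypeElementaryTwoGroupOddWeights
import Mathlib.GroupTheory.SpecificGroups.Cyclic
import Mathlib.RingTheory.RootsOfUnity.PrimitiveRoots
import HarnessLib

/-!
# The two atoms through an involution of a finite commutative group: models, odd characters, induced CM sets

COR-CM (cell `pub-hodgecm2`), binder seat b04 (gen 18), count-neutral claim ABELIAN-ODD-PART, part IIIa (pure group
theory + characters).  KERNEL ONLY: theorems; no definition, no named fact, no `sorry`.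

Let `G` be a finite commutative group and `c ∈ G` an involution (`c ≠ 1`, `c² = 1`).

* §1 **`exists_cmset_char_of_pair`** (atom A of part IIb through `c`): `u, v` of odd prime order `p`,
  `v ∉ ⟨u⟩` ⟹ after a change of basis an odd character `χ` with `χ(u) ≠ 1`, `χ(v) = 1`
  (`exists_oddChar_basis`, discrete logarithm in `μ_p` by `IsPrimitiveRoot.eq_pow_of_pow_eq_one`), the injective
  model `ℤ/2 × (ℤ/p × ℤ/p) ↪ G`, `(i,a,b) ↦ cⁱ uᵃ vᵇ` (`exists_model_pair`), and part IIa's model induction: a CM set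
  `T ⊆ G` for `c` with trivial stabiliser and `Σ_T χ = 0`.
* §2 **`exists_cmset_char_of_involution`** (atom B through `c`): a second involution `t` and `u` of odd order
  `n ≥ 3` ⟹ the odd character `χ = n·χ₁` is trivial on `u`, and on `t` or on `ct`; the model
  `ℤ/2 × (ℤ/2 × ℤ/n) ↪ G` (`exists_model_involution`); a CM set with trivial stabiliser killed by `χ`.

Part IIIb (`CorCM/AbelianCMFieldsOddPartClassification`) shows that a NON-cyclic `G` of order `2^{a+1} m`, `m` odd `≠ 1`,
contains one of the two configurations through `c` and dresses the result on `Gal(K/ℚ)`.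

## References

* [Kubota1965] T. Kubota, *On the field extension by complex multiplication*, Trans. AMS 118 (1965), §4 Lemma 2.
* [Shimura1998] G. Shimura, *Abelian Varieties with Complex Multiplication and Modular Functions*, §8.2 Prop. 26.
* [Dodson1984] B. Dodson, *The structure of Galois groups of CM-fields*, Trans. AMS 283 (1984), §3.2.1.
-/

noncomputable section

namespace Summit.HodgeConjecture.CorCM.AbelianOddPart

open Literature.NumberTheory.ComplexMultiplication (exists_oddCharacter_apply_ne_one
  character_apply_eq_one_or_of_mul_self)
open Summit.HodgeConjecture.CorCM.TwoGroupPieces (exists_zmodHom zmod_two_cases)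

open scoped Classical

variable {G : Type*} [CommGroup G] [Fintype G]

/-! ## §1 Atom A through `c`: two independent elements of odd prime order -/

omit [Fintype G] in
/-- Powers stay in `⟨u⟩`; `v·uᵏ ∉ ⟨u⟩` if `v ∉ ⟨u⟩`. [folklore] -/
theorem mul_pow_not_mem_zpowers {u v : G} (huv : v ∉ Subgroup.zpowers u) (k : ℕ) :
    v * u ^ k ∉ Subgroup.zpowers u := fun h => huv (by
  have h' := (Subgroup.zpowers u).mul_mem h ((Subgroup.zpowers u).inv_mem
    ((Subgroup.zpowers u).pow_mem (Subgroup.mem_zpowers u) k))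
  rwa [mul_inv_cancel_right] at h')

/-- **Change of basis adapted to an odd character.**  For an involution `c ≠ 1` and `u, v` of prime order `p`
with `v ∉ ⟨u⟩` there are an odd character `χ` (`χ(c) = −1`) and a new pair `u, v' = v uᵏ` of order `p`,
`v' ∉ ⟨u⟩`, with `χ(u) ≠ 1` and `χ(v') = 1` (characters separate points; discrete logarithm in `μ_p`).
[cite: Kubota1965, §4 Lemma 2 (proof)] -/
theorem exists_oddChar_basis {c u v : G} (hc1 : c ≠ 1) (hcc : c * c = 1) {p : ℕ} (hp : p.Prime)
    (hu : orderOf u = p) (hv : orderOf v = p) (huv : v ∉ Subgroup.zpowers u) :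
    ∃ (v' : G) (χ : AddChar (Additive G) ℂ), orderOf v' = p ∧ v' ∉ Subgroup.zpowers u ∧
      χ (Additive.ofMul c) = -1 ∧ χ (Additive.ofMul u) ≠ 1 ∧ χ (Additive.ofMul v') = 1 := by
  haveI : Fact p.Prime := ⟨hp⟩
  haveI : NeZero p := ⟨hp.ne_zero⟩
  have hu1 : u ≠ 1 := fun h => hp.one_lt.ne' (by rw [← hu, h, orderOf_one])
  obtain ⟨χ, hχc, hχu⟩ := exists_oddCharacter_apply_ne_one hc1 hcc hu1
  -- `ω = χ(u)` is a primitive `p`-th root of unity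
  have hpow : ∀ g : G, orderOf g = p → χ (Additive.ofMul g) ^ p = 1 := fun g hg => by
    rw [← AddChar.map_nsmul_eq_pow, ← ofMul_pow, ← hg, pow_orderOf_eq_one, ofMul_one, AddChar.map_zero_eq_one]
  have hω : IsPrimitiveRoot (χ (Additive.ofMul u)) p := by
    have h := IsPrimitiveRoot.orderOf (χ (Additive.ofMul u))
    rwa [orderOf_eq_prime (hpow u hu) hχu] at h
  -- discrete logarithm of `χ(v)⁻¹`
  have hvinv : χ (Additive.ofMul v⁻¹) ^ p = 1 := hpow v⁻¹ (by rw [orderOf_inv, hv])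
  obtain ⟨k, -, hk⟩ := hω.eq_pow_of_pow_eq_one hvinv
  have hup : u ^ p = 1 := hu ▸ pow_orderOf_eq_one u
  have hvp : v ^ p = 1 := hv ▸ pow_orderOf_eq_one v
  refine ⟨v * u ^ k, χ, ?_, mul_pow_not_mem_zpowers huv k, hχc, hχu, ?_⟩
  · refine orderOf_eq_prime ?_ fun h => mul_pow_not_mem_zpowers huv k (by rw [h]; exact one_mem _)
    rw [mul_pow, ← pow_mul, hvp, one_mul, mul_comm k p, pow_mul, hup, one_pow]
  · rw [ofMul_mul, AddChar.map_add_eq_mul, ofMul_pow, AddChar.map_nsmul_eq_pow, hk, ← AddChar.map_add_eq_mul,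
      ← ofMul_mul, mul_inv_cancel, ofMul_one, AddChar.map_zero_eq_one]

omit [Fintype G] in
/-- In a group: `x² = 1`, `x^n = 1`, `n` odd ⟹ `x = 1`. [folklore] -/
theorem eq_one_of_sq_of_odd_pow {x : G} (h2 : x * x = 1) {n : ℕ} (hn : Odd n) (hxn : x ^ n = 1) : x = 1 := by
  obtain ⟨r, rfl⟩ := hn
  rw [pow_succ, pow_mul, pow_two, h2, one_pow, one_mul] at hxn
  exact hxn

omit [Fintype G] in
/-- **The model `ℤ/2 × (ℤ/p × ℤ/p) ↪ G`, `(i, a, b) ↦ cⁱ uᵃ vᵇ`** for an involution `c ≠ 1` and independent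
`u, v` of odd prime order `p`: an injective homomorphism with `(1,0) ↦ c`, `(0,(1,0)) ↦ u`, `(0,(0,1)) ↦ v`.
[folklore] -/
theorem exists_model_pair {c u v : G} (hc1 : c ≠ 1) (hcc : c * c = 1) {p : ℕ} (hp : p.Prime) (hp2 : p ≠ 2)
    (hu : orderOf u = p) (hv : orderOf v = p) (huv : v ∉ Subgroup.zpowers u) :
    ∃ j : ZMod 2 × (ZMod p × ZMod p) →+ Additive G, Function.Injective j ∧
      j (1, 0) = Additive.ofMul c ∧ j (0, (1, 0)) = Additive.ofMul u ∧ j (0, (0, 1)) = Additive.ofMul v := by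
  haveI : Fact p.Prime := ⟨hp⟩
  haveI : NeZero p := ⟨hp.ne_zero⟩
  haveI : Fact (1 < p) := ⟨hp.one_lt⟩
  have hxc : 2 • Additive.ofMul c = 0 := by rw [two_nsmul, ← ofMul_mul, hcc, ofMul_one]
  have hxu : p • Additive.ofMul u = 0 := by rw [← ofMul_pow, ← hu, pow_orderOf_eq_one, ofMul_one]
  have hxv : p • Additive.ofMul v = 0 := by rw [← ofMul_pow, ← hv, pow_orderOf_eq_one, ofMul_one]
  obtain ⟨lc, hlc⟩ := exists_zmodHom 2 (Additive.ofMul c) hxc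
  obtain ⟨lu, hlu⟩ := exists_zmodHom p (Additive.ofMul u) hxu
  obtain ⟨lv, hlv⟩ := exists_zmodHom p (Additive.ofMul v) hxv
  set j : ZMod 2 × (ZMod p × ZMod p) →+ Additive G := lc.coprod (lu.coprod lv) with hj
  have hjapp : ∀ (i : ZMod 2) (a b : ZMod p),
      j (i, (a, b)) = i.val • Additive.ofMul c + (a.val • Additive.ofMul u + b.val • Additive.ofMul v) := by
    intro i a b
    rw [hj, AddMonoidHom.coprod_apply, AddMonoidHom.coprod_apply, hlc, hlu, hlv]
  have hjmul : ∀ (i : ZMod 2) (a b : ZMod p),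
      Additive.toMul (j (i, (a, b))) = c ^ i.val * (u ^ a.val * v ^ b.val) := by
    intro i a b
    rw [hjapp, toMul_add, toMul_add, toMul_nsmul, toMul_nsmul, toMul_nsmul, toMul_ofMul, toMul_ofMul,
      toMul_ofMul]
  refine ⟨j, ?_, ?_, ?_, ?_⟩
  · rw [injective_iff_map_eq_zero]
    rintro ⟨i, a, b⟩ H
    have Hm : c ^ i.val * (u ^ a.val * v ^ b.val) = 1 := by rw [← hjmul, H, toMul_zero]
    -- the `p`-th power kills `u, v`
    have hup : u ^ p = 1 := hu ▸ pow_orderOf_eq_one u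
    have hvp : v ^ p = 1 := hv ▸ pow_orderOf_eq_one v
    have hw : (u ^ a.val * v ^ b.val) ^ p = 1 := by
      rw [mul_pow, ← pow_mul, ← pow_mul, mul_comm a.val p, mul_comm b.val p, pow_mul, pow_mul, hup, hvp,
        one_pow, one_pow, one_mul]
    -- `i = 0`
    have hi : i = 0 := by
      rcases zmod_two_cases i with h | h
      · exact h
      · exfalso
        subst h
        have hval : (1 : ZMod 2).val = 1 := rfl
        rw [hval, pow_one] at Hm
        have hcinv : c = (u ^ a.val * v ^ b.val)⁻¹ := eq_inv_of_mul_eq_one_left Hm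
        have hcp : c ^ p = 1 := by rw [hcinv, inv_pow, hw, inv_one]
        exact hc1 (eq_one_of_sq_of_odd_pow hcc (hp.odd_of_ne_two hp2) hcp)
    subst hi
    rw [ZMod.val_zero, pow_zero, one_mul] at Hm
    -- `b = 0`
    have hb : b = 0 := by
      by_contra hb
      have hbval : b.val ≠ 0 := fun h => hb ((ZMod.val_eq_zero b).1 h)
      have hcop : b.val.Coprime (orderOf v) := by
        rw [hv, Nat.coprime_comm, Nat.Prime.coprime_iff_not_dvd hp]
        exact fun hd => absurd (Nat.le_of_dvd (Nat.pos_of_ne_zero hbval) hd) (not_le.2 (ZMod.val_lt b))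
      obtain ⟨e, he⟩ := exists_pow_eq_self_of_coprime hcop
      apply huv
      have hvb : v ^ b.val = (u ^ a.val)⁻¹ := eq_inv_of_mul_eq_one_right Hm
      rw [← he, hvb]
      exact (Subgroup.zpowers u).pow_mem ((Subgroup.zpowers u).inv_mem
        ((Subgroup.zpowers u).pow_mem (Subgroup.mem_zpowers u) _)) _
    subst hb
    rw [ZMod.val_zero, pow_zero, mul_one] at Hm
    -- `a = 0`
    have ha : a = 0 := by
      by_contra ha
      have haval : a.val ≠ 0 := fun h => ha ((ZMod.val_eq_zero a).1 h)
      exact pow_ne_one_of_lt_orderOf haval (by rw [hu]; exact ZMod.val_lt a) Hm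
    subst ha
    rfl
  · have hval1 : (1 : ZMod 2).val = 1 := rfl
    rw [show ((1 : ZMod 2), (0 : ZMod p × ZMod p)) = ((1 : ZMod 2), ((0 : ZMod p), (0 : ZMod p))) from rfl,
      hjapp, ZMod.val_zero, zero_nsmul, zero_nsmul, add_zero, add_zero, hval1, one_nsmul]
  · rw [hjapp, ZMod.val_zero, ZMod.val_one, zero_nsmul, zero_add, one_nsmul, ZMod.val_zero, zero_nsmul,
      add_zero]
  · rw [hjapp, ZMod.val_zero, ZMod.val_one, zero_nsmul, zero_add, ZMod.val_zero, zero_nsmul, zero_add,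
      one_nsmul]

/-- **Atom A through `c` (group level).**  An involution `c ≠ 1` and two independent elements `u, v` of odd
prime order `p` in a finite commutative group `G` yield a CM set `T ⊆ G` for `c` with TRIVIAL stabiliser and an
ODD character `χ` with `Σ_T χ = 0` (part IIb's atom A induced along `ℤ/2 × (ℤ/p × ℤ/p) ↪ G`).
[cite: Kubota1965, §4 Lemma 2] [cite: Shimura1998, §8.2 Prop. 26] -/
theorem exists_cmset_char_of_pair {c u v : G} (hc1 : c ≠ 1) (hcc : c * c = 1) {p : ℕ} (hp : p.Prime)
    (hp2 : p ≠ 2) (hu : orderOf u = p) (hv : orderOf v = p) (huv : v ∉ Subgroup.zpowers u) :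
    ∃ (T : Finset G) (χ : AddChar (Additive G) ℂ), (∀ g : G, g ∈ T ↔ c * g ∉ T) ∧
      (∀ w : G, w ≠ 1 → ∃ x : G, ¬ (x ∈ T ↔ w * x ∈ T)) ∧ χ (Additive.ofMul c) = -1 ∧
      ∑ g ∈ T, χ (Additive.ofMul g) = 0 := by
  obtain ⟨v', χ, hv', huv', hχc, hχu, hχv⟩ := exists_oddChar_basis hc1 hcc hp hu hv huv
  obtain ⟨j, hj, hjc, hju, hjv⟩ := exists_model_pair hc1 hcc hp hp2 hu hv' huv'
  have h3 : 3 ≤ p := by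
    have h2 := hp.two_le
    omega
  obtain ⟨T₀, T₁, hcm₀, hcm₁, hprim, hntr, hsum⟩ := atomA h3
  obtain ⟨h0, h1⟩ := hsum (χ.compAddMonoidHom j) (by rw [AddChar.compAddMonoidHom_apply, hjc, hχc])
    (by rw [AddChar.compAddMonoidHom_apply, hju]; exact hχu) (by rw [AddChar.compAddMonoidHom_apply, hjv, hχv])
  simp only [AddChar.compAddMonoidHom_apply] at h0 h1
  obtain ⟨T, hcm, hpr, hχT⟩ := exists_finset_of_model_char j hj (1, 0) T₀ T₁ hcm₀ hcm₁ hprim hntr χ h0 h1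
  rw [hjc, toMul_ofMul] at hcm
  exact ⟨T, χ, hcm, hpr, hχc, hχT⟩

/-! ## §2 Atom B through `c`: a second involution and an element of odd order `≥ 3` -/

/-- **The model `ℤ/2 × (ℤ/2 × ℤ/n) ↪ G`, `(i, j, k) ↦ cⁱ tʲ uᵏ`** for distinct commuting involutions `c, t ≠ 1`
and `u` of odd order `n`: an injective homomorphism with `(1,0) ↦ c`, `(0,(1,0)) ↦ t`, `(0,(0,1)) ↦ u`.
[folklore] -/
theorem exists_model_involution {c t u : G} (hc1 : c ≠ 1) (hcc : c * c = 1) (ht1 : t ≠ 1) (htc : t ≠ c)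
    (htt : t * t = 1) (hodd : Odd (orderOf u)) :
    ∃ j : ZMod 2 × (ZMod 2 × ZMod (orderOf u)) →+ Additive G, Function.Injective j ∧
      j (1, 0) = Additive.ofMul c ∧ j (0, (1, 0)) = Additive.ofMul t ∧ j (0, (0, 1)) = Additive.ofMul u := by
  set n := orderOf u with hn
  haveI : NeZero n := ⟨(orderOf_pos u).ne'⟩
  have hxc : 2 • Additive.ofMul c = 0 := by rw [two_nsmul, ← ofMul_mul, hcc, ofMul_one]
  have hxt : 2 • Additive.ofMul t = 0 := by rw [two_nsmul, ← ofMul_mul, htt, ofMul_one]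
  have hxu : n • Additive.ofMul u = 0 := by rw [← ofMul_pow, hn, pow_orderOf_eq_one, ofMul_one]
  obtain ⟨lc, hlc⟩ := exists_zmodHom 2 (Additive.ofMul c) hxc
  obtain ⟨lt, hlt⟩ := exists_zmodHom 2 (Additive.ofMul t) hxt
  obtain ⟨lu, hlu⟩ := exists_zmodHom n (Additive.ofMul u) hxu
  set j : ZMod 2 × (ZMod 2 × ZMod n) →+ Additive G := lc.coprod (lt.coprod lu) with hj
  have hjapp : ∀ (i a : ZMod 2) (b : ZMod n),
      j (i, (a, b)) = i.val • Additive.ofMul c + (a.val • Additive.ofMul t + b.val • Additive.ofMul u) := by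
    intro i a b
    rw [hj, AddMonoidHom.coprod_apply, AddMonoidHom.coprod_apply, hlc, hlt, hlu]
  have hjmul : ∀ (i a : ZMod 2) (b : ZMod n),
      Additive.toMul (j (i, (a, b))) = c ^ i.val * (t ^ a.val * u ^ b.val) := by
    intro i a b
    rw [hjapp, toMul_add, toMul_add, toMul_nsmul, toMul_nsmul, toMul_nsmul, toMul_ofMul, toMul_ofMul,
      toMul_ofMul]
  have hval1 : (1 : ZMod 2).val = 1 := rfl
  refine ⟨j, ?_, ?_, ?_, ?_⟩
  · rw [injective_iff_map_eq_zero]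
    rintro ⟨i, a, b⟩ H
    have Hm : c ^ i.val * (t ^ a.val * u ^ b.val) = 1 := by rw [← hjmul, H, toMul_zero]
    -- `w = cⁱ tᵃ` squares to `1` and equals `u^{-b}`, which has odd order: both are `1`
    set w : G := c ^ i.val * t ^ a.val with hw
    have hww : w * w = 1 := by
      have hci : c ^ i.val * c ^ i.val = 1 := by rw [← pow_add, ← two_mul, pow_mul, pow_two, hcc, one_pow]
      have hta : t ^ a.val * t ^ a.val = 1 := by rw [← pow_add, ← two_mul, pow_mul, pow_two, htt, one_pow]
      calc w * w = (c ^ i.val * c ^ i.val) * (t ^ a.val * t ^ a.val) := by rw [hw]; simp only [mul_assoc, mul_left_comm]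
        _ = 1 := by rw [hci, hta, one_mul]
    have hwu : w * u ^ b.val = 1 := by rw [hw, mul_assoc]; exact Hm
    have hub : u ^ b.val = 1 := by
      have hsq : u ^ b.val * u ^ b.val = 1 := by
        have h := eq_inv_of_mul_eq_one_right hwu
        rw [h, ← mul_inv, hww, inv_one]
      refine eq_one_of_sq_of_odd_pow hsq hodd ?_
      have hun : u ^ n = 1 := pow_orderOf_eq_one u
      rw [← pow_mul, mul_comm, pow_mul, hun, one_pow]
    rw [hub, mul_one] at hwu
    -- `b = 0`
    have hb : b = 0 := by
      by_contra hb
      have hbval : b.val ≠ 0 := fun h => hb ((ZMod.val_eq_zero b).1 h)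
      exact pow_ne_one_of_lt_orderOf hbval (ZMod.val_lt b) hub
    subst hb
    -- `(i, a) = (0, 0)`
    rcases zmod_two_cases i with rfl | rfl <;>
      rcases zmod_two_cases a with rfl | rfl
    · rfl
    · exfalso
      rw [hw, ZMod.val_zero, hval1, pow_zero, pow_one, one_mul] at hwu
      exact ht1 hwu
    · exfalso
      rw [hw, ZMod.val_zero, hval1, pow_zero, pow_one, mul_one] at hwu
      exact hc1 hwu
    · exfalso
      rw [hw, hval1, pow_one, pow_one] at hwu
      have h := eq_inv_of_mul_eq_one_right hwu
      rw [inv_eq_of_mul_eq_one_right hcc] at h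
      exact htc h
  · rw [show ((1 : ZMod 2), (0 : ZMod 2 × ZMod n)) = ((1 : ZMod 2), ((0 : ZMod 2), (0 : ZMod n))) from rfl,
      hjapp, ZMod.val_zero, ZMod.val_zero, zero_nsmul, zero_nsmul, add_zero, add_zero, hval1, one_nsmul]
  · rw [hjapp, ZMod.val_zero, hval1, zero_nsmul, zero_add, one_nsmul, ZMod.val_zero, zero_nsmul, add_zero]
  · rw [hjapp, ZMod.val_zero, zero_nsmul, zero_add, zero_nsmul, zero_add]
    by_cases h1 : n = 1
    · -- `n = 1`: `u = 1`
      have hu1 : u = 1 := orderOf_eq_one_iff.1 (hn ▸ h1)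
      have : ((1 : ZMod n).val) • Additive.ofMul u = Additive.ofMul u := by
        rw [hu1, ofMul_one, nsmul_zero]
      exact this
    · haveI : Fact (1 < n) := ⟨lt_of_le_of_ne (Nat.pos_of_ne_zero (NeZero.ne n)) (Ne.symm h1)⟩
      rw [ZMod.val_one, one_nsmul]

/-- **Atom B through `c` (group level).**  An involution `c ≠ 1`, a second involution `t ∉ {1, c}` and an
element `u` of odd order `≥ 3` in a finite commutative group yield a CM set `T ⊆ G` for `c` with TRIVIAL
stabiliser and an ODD character `χ` with `Σ_T χ = 0` (`χ = n·χ₁` is trivial on `u` and on `t` or `ct`; part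
IIb's atom B induced along `ℤ/2 × (ℤ/2 × ℤ/n) ↪ G`). [cite: Kubota1965, §4 Lemma 2] [cite: Shimura1998, §8.2
Prop. 26] [cite: Gordon1999HodgeAVSurvey, §9.4.3 (Theorem [B.140])] -/
theorem exists_cmset_char_of_involution {c t u : G} (hc1 : c ≠ 1) (hcc : c * c = 1) (ht1 : t ≠ 1)
    (htc : t ≠ c) (htt : t * t = 1) (hodd : Odd (orderOf u)) (h3 : 3 ≤ orderOf u) :
    ∃ (T : Finset G) (χ : AddChar (Additive G) ℂ), (∀ g : G, g ∈ T ↔ c * g ∉ T) ∧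
      (∀ w : G, w ≠ 1 → ∃ x : G, ¬ (x ∈ T ↔ w * x ∈ T)) ∧ χ (Additive.ofMul c) = -1 ∧
      ∑ g ∈ T, χ (Additive.ofMul g) = 0 := by
  set n := orderOf u with hn
  -- an odd character trivial on `u`
  obtain ⟨χ₁, hχ₁c, -⟩ := exists_oddCharacter_apply_ne_one hc1 hcc hc1
  set χ : AddChar (Additive G) ℂ := n • χ₁ with hχ
  have hχc : χ (Additive.ofMul c) = -1 := by rw [hχ, AddChar.nsmul_apply, hχ₁c, hodd.neg_one_pow]
  have hχu : χ (Additive.ofMul u) = 1 := by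
    rw [hχ, AddChar.nsmul_apply, ← AddChar.map_nsmul_eq_pow, ← ofMul_pow, hn, pow_orderOf_eq_one, ofMul_one,
      AddChar.map_zero_eq_one]
  -- `t' ∈ {t, ct}` with `χ(t') = 1`
  obtain ⟨t', ht'1, ht'c, ht't', hχt'⟩ : ∃ t' : G, t' ≠ 1 ∧ t' ≠ c ∧ t' * t' = 1 ∧ χ (Additive.ofMul t') = 1 := by
    rcases character_apply_eq_one_or_of_mul_self χ htt with h | h
    · exact ⟨t, ht1, htc, htt, h⟩
    · refine ⟨c * t, fun h' => htc ?_, fun h' => ht1 ?_, ?_, ?_⟩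
      · have h'' := eq_inv_of_mul_eq_one_right h'
        rwa [inv_eq_of_mul_eq_one_right hcc] at h''
      · exact mul_left_cancel (a := c) (by rw [h', mul_one])
      · calc c * t * (c * t) = (c * c) * (t * t) := by simp only [mul_assoc, mul_left_comm]
          _ = 1 := by rw [hcc, htt, one_mul]
      · rw [ofMul_mul, AddChar.map_add_eq_mul, hχc, h]
        norm_num
  obtain ⟨j, hj, hjc, hjt, hju⟩ := exists_model_involution hc1 hcc ht'1 ht'c ht't' hodd
  obtain ⟨T₀, T₁, hcm₀, hcm₁, hprim, hntr, hsum⟩ := atomB h3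
  obtain ⟨h0, h1⟩ := hsum (χ.compAddMonoidHom j) (by rw [AddChar.compAddMonoidHom_apply, hjc, hχc])
    (by rw [AddChar.compAddMonoidHom_apply, hjt, hχt']) (by rw [AddChar.compAddMonoidHom_apply, hju, hχu])
  simp only [AddChar.compAddMonoidHom_apply] at h0 h1
  obtain ⟨T, hcm, hpr, hχT⟩ := exists_finset_of_model_char j hj (1, 0) T₀ T₁ hcm₀ hcm₁ hprim hntr χ h0 h1
  rw [hjc, toMul_ofMul] at hcm
  exact ⟨T, χ, hcm, hpr, hχc, hχT⟩

end Summit.HodgeConjecture.CorCM.AbelianOddPart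

end
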